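import Literature.Probability.RandomPlanarGeometry.HexSAWStripWidthTwoContactMomentLaws
import Literature.Probability.RandomPlanarGeometry.HexSAWStripWidthThreeContactSkewness
import Literature.Probability.RandomPlanarGeometry.HexSAWStripWidthThreeEnclosure
import HarnessLib

/-!
# The width-two strip at criticality: the cubic law of `Ĉ³`, the THIRD CENTRAL MOMENT of the contact count is linear in the length, and its rate is the
# exact constant `κ₃(T = 2) = (13836 − 9785√2)/16 = −0.12998…` per step (module «WIDTH-TWO CONTACT SKEWNESS»)

Topic `Literature/Probability/RandomPlanarGeometry` (continues «WIDTH-TWO CONTACT MOMENT LAWS» — `W2.exists_hatC2D_two_quadratic_det`, `W2.cDetTwo`, `W2.linQTwoDet`,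
`W2.cubA/B/CTwoDet`, the scalars `tOneTwo … trryTwo` and their closed forms, `W2.qMonicTwo`, `W2.rTwoDet` —, «WIDTH-TWO HAT CONTACT ANNIHILATOR»
(`W2.detYTwo_contact_cube_annihilator`, `W2.hatC3DTwo`), the model-free cubic law «LINEAR RECURRENCE WITH QUADRATIC SOURCE» and the third-central-moment algebra
`W3.tendsto_ratio_third_central_sub_linear` of «WIDTH-THREE CONTACT SKEWNESS» (model-free plumbing stated there); «WIDTH-TWO CONTACT VARIANCE RATE» #1137 for
comparison (`σ̂₂ = (96 − 67√2)/4`)).  Lane «pcv-sawmu» (CriticalPhenomena venture), a-p2 g29.  RESULT: by the det route (no projector algebra), `c = ½ + x² = 2θ₂`,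
`c₂ − c² = (96 − 67√2)/4` (the variance rate of #1137, re-derived from `det(λ − G₂)` — an independent check), and the NEW exact constant
`κ̂₃ = L₃ − 3L₁L₂ + 2L₁³ = 3459/2 − 9785√2/8` per hat index, **`κ₃(T=2) = (13836 − 9785√2)/16 = −0.129981738795940…` per step** — the third cumulant rate
whose 17 digits `FINDING-WIDTH-THREE-CONTACT-VARIANCE-CONJECTURE.md` §2 printed from a kit.  Frame: W. Feller I (1968) XIII.6; nothing below is printed.

## What is proved (namespace `…SAW.HV.W2`)
* §1 `hatC3D_two_source`, `hatC3D_two_recurrence_bound`, ★★★ `exists_hatC3D_two_cubic` (`|Ĉ³(n+1) − (α/3·n³ + …)| ≤ K(n+1)⁹Rⁿ`, `α/3 = c³A`).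
* §2 `cThreeDetTwo` (`L₃`), ★ `kappaHatTwo`, ★ `kappaStepTwo`, `thirdTopTwo`; `cubic_constants_two`, `skewRate_identity_two`; ★★★ **`tendsto_thirdTopTwo_sub_linear`**
  (`∃ W, third central moment (k+1) − κ̂₃(k+1) → W`), `tendsto_thirdTopTwo_div`, `tendsto_div_hatLen_two`, ★★★ `tendsto_thirdTopTwo_div_hatLen` (per step `→ κ₃`).
* §3 ★★ `cDetTwo_eq` (`c = ½ + x²`), ★★ `varRateDet_two_eq` (`c₂ − c² = (96 − 67√2)/4`, agreeing with #1137), ★★★ **`kappaStepTwo_eq`** (`κ₃ = (13836 − 9785√2)/16`),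
  `kappaStepTwo_window` (`−0.12998174 < κ₃ < −0.12998173`).

Label: LANE THEOREM (own result of lane «pcv-sawmu», a-p2 g29, 2026-08-28; not in print).  NOT claimed: a CLT statement for the third cumulant; `T ≥ 4`.
-/

noncomputable section

open Finset Filter Topology Matrix Polynomial Literature.Probability.LatticeModels Literature.Probability.Percolation

namespace Literature.Probability.RandomPlanarGeometry.SAW

namespace HV

namespace W2

/-! ## §1 The cubic law of `Ĉ³` -/

/-- The source of the `Ĉ³` recurrence of `S₂` in terms of the lower-moment errors (from `detYTwo_contact_cube_annihilator`; `ẗ = t⃛ = ṫ`).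
[cite: Feller1968, XIII.6; lane «pcv-sawmu» a-p2 g29] -/
theorem hatC3D_two_source (a b : Fin (2 * 2)) (m₀ m₂ : ℝ) (n : ℕ) :
    ∑ r ∈ range 5, detYTwo (stripYT 2) r * hatC3DTwo (stripYT 2) (n + r + 1) a b
        - (cubSrc2TwoDet (limTwo a b) * (n : ℝ) ^ 2 + cubSrc1TwoDet (limTwo a b) m₀ * (n : ℝ) + cubSrc0TwoDet (limTwo a b) m₀ m₂)
      = -(3 * ∑ r ∈ range 5, detYTwoDot (stripYT 2) r * (hatC2D (stripYT 2) (n + r + 1) a b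
            - (cDetTwo ^ 2 * limTwo a b * ((n + r : ℕ) : ℝ) ^ 2 + linQTwoDet (limTwo a b) m₀ * ((n + r : ℕ) : ℝ) + m₂))
          + 3 * ∑ r ∈ range 5, detYTwoDot (stripYT 2) r * (hatCD (stripYT 2) (n + r + 1) a b - (cDetTwo * limTwo a b * ((n + r : ℕ) : ℝ) + m₀))
          + ∑ r ∈ range 5, detYTwoDot (stripYT 2) r * (hatD 2 (stripYT 2) (n + r + 1) a b - limTwo a b)) := by
  have hy : 0 < stripYT 2 := stripYT_pos (by norm_num)
  have h := detYTwo_contact_cube_annihilator hy a b n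
  set A := limTwo a b with hA
  set ℓ := linQTwoDet A m₀ with hℓ
  have e2 : ∑ r ∈ range 5, detYTwoDot (stripYT 2) r * (hatC2D (stripYT 2) (n + r + 1) a b
        - (cDetTwo ^ 2 * A * ((n + r : ℕ) : ℝ) ^ 2 + ℓ * ((n + r : ℕ) : ℝ) + m₂))
      = ∑ r ∈ range 5, detYTwoDot (stripYT 2) r * hatC2D (stripYT 2) (n + 1 + r) a b
        - (cDetTwo ^ 2 * A * ((n : ℝ) ^ 2 * tyTwo + 2 * (n : ℝ) * tlyTwo + trryTwo) + ℓ * ((n : ℝ) * tyTwo + tlyTwo) + m₂ * tyTwo) := by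
    rw [tyTwo, tlyTwo, trryTwo]
    simp only [Finset.mul_sum, ← Finset.sum_add_distrib, ← Finset.sum_sub_distrib, mul_add]
    refine Finset.sum_congr rfl fun r _ => ?_
    rw [show n + r + 1 = n + 1 + r by ring]; push_cast; ring
  have e1 : ∑ r ∈ range 5, detYTwoDot (stripYT 2) r * (hatCD (stripYT 2) (n + r + 1) a b - (cDetTwo * A * ((n + r : ℕ) : ℝ) + m₀))
      = ∑ r ∈ range 5, detYTwoDot (stripYT 2) r * hatCD (stripYT 2) (n + 1 + r) a b - (cDetTwo * A * ((n : ℝ) * tyTwo + tlyTwo) + m₀ * tyTwo) := by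
    rw [tyTwo, tlyTwo]
    simp only [Finset.mul_sum, ← Finset.sum_add_distrib, ← Finset.sum_sub_distrib, mul_add]
    refine Finset.sum_congr rfl fun r _ => ?_
    rw [show n + r + 1 = n + 1 + r by ring]; push_cast; ring
  have e0 : ∑ r ∈ range 5, detYTwoDot (stripYT 2) r * (hatD 2 (stripYT 2) (n + r + 1) a b - A)
      = ∑ r ∈ range 5, detYTwoDot (stripYT 2) r * hatD 2 (stripYT 2) (n + 1 + r) a b - tyTwo * A := by
    rw [tyTwo, Finset.sum_mul, ← Finset.sum_sub_distrib]
    exact Finset.sum_congr rfl fun r _ => by rw [show n + r + 1 = n + 1 + r by ring]; ring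
  have e3 : ∑ r ∈ range 5, detYTwo (stripYT 2) r * hatC3DTwo (stripYT 2) (n + r + 1) a b
      = ∑ r ∈ range 5, detYTwo (stripYT 2) r * hatC3DTwo (stripYT 2) (n + 1 + r) a b :=
    Finset.sum_congr rfl fun r _ => by rw [show n + r + 1 = n + 1 + r by ring]
  rw [e2, e1, e0, e3, cubSrc2TwoDet, cubSrc1TwoDet, cubSrc0TwoDet]
  linear_combination h

/-- The recurrence-with-source estimate for `Ĉ³(n+1)_{ab}` of `S₂`. [cite: Feller1968, XIII.6; Stanley2012EC1, §4.1 Theorem 4.1.1 (iii); lane «pcv-sawmu» a-p2 g29] -/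
theorem hatC3D_two_recurrence_bound (a b : Fin (2 * 2)) {m₀ m₂ K₁ : ℝ} (hK₁ : 0 ≤ K₁)
    (hb₁ : ∀ n : ℕ, |hatCD (stripYT 2) (n + 1) a b - (cDetTwo * limTwo a b * (n : ℝ) + m₀)| ≤ K₁ * ((n : ℝ) + 1) ^ 3 * rTwoDet ^ n)
    (hb₂ : ∀ n : ℕ, |hatC2D (stripYT 2) (n + 1) a b - (cDetTwo ^ 2 * limTwo a b * (n : ℝ) ^ 2 + linQTwoDet (limTwo a b) m₀ * (n : ℝ) + m₂)|
      ≤ K₁ * ((n : ℝ) + 1) ^ 6 * rTwoDet ^ n) :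
    ∃ K : ℝ, 0 ≤ K ∧ ∀ n : ℕ,
    ‖∑ j ∈ range (qMonicTwo.natDegree + 1), qMonicTwo.coeff j
        * (((hatC3DTwo (stripYT 2) (n + 1 + j + 1) a b : ℝ) : ℂ) - ((hatC3DTwo (stripYT 2) (n + j + 1) a b : ℝ) : ℂ))
        - (((cubSrc2TwoDet (limTwo a b) : ℝ) : ℂ) * (n : ℂ) ^ 2 + ((cubSrc1TwoDet (limTwo a b) m₀ : ℝ) : ℂ) * (n : ℂ)
          + ((cubSrc0TwoDet (limTwo a b) m₀ m₂ : ℝ) : ℂ))‖ ≤ K * ((n : ℝ) + 1) ^ 6 * rTwoDet ^ n := by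
  obtain ⟨hR0, hR1, -, -⟩ := rTwoDet_facts
  obtain ⟨K₀, hK₀', hK₀⟩ := abs_hatD_two_sub_lim_le
  set S₂ : ℝ := K₁ * ∑ r ∈ range 5, |detYTwoDot (stripYT 2) r| * ((r : ℝ) + 1) ^ 6 with hS₂
  set S₁ : ℝ := K₁ * ∑ r ∈ range 5, |detYTwoDot (stripYT 2) r| * ((r : ℝ) + 1) ^ 3 with hS₁
  set S₀ : ℝ := K₀ * ∑ r ∈ range 5, |detYTwoDot (stripYT 2) r| * ((r : ℝ) + 1) ^ 0 with hS₀
  have hS₂0 : 0 ≤ S₂ := mul_nonneg hK₁ (Finset.sum_nonneg fun r _ => by positivity)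
  have hS₁0 : 0 ≤ S₁ := mul_nonneg hK₁ (Finset.sum_nonneg fun r _ => by positivity)
  have hS₀0 : 0 ≤ S₀ := mul_nonneg hK₀' (Finset.sum_nonneg fun r _ => by positivity)
  refine ⟨3 * S₂ + 3 * S₁ + S₀, by linarith, fun n => ?_⟩
  rw [sum_coeff_qMonicTwo_diff (fun m => hatC3DTwo (stripYT 2) (m + 1) a b) n]
  rw [← Complex.ofReal_natCast, ← Complex.ofReal_pow, ← Complex.ofReal_mul, ← Complex.ofReal_mul, ← Complex.ofReal_add, ← Complex.ofReal_add,
    ← Complex.ofReal_sub, Complex.norm_real, Real.norm_eq_abs, hatC3D_two_source a b m₀ m₂ n, abs_neg]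
  have h2 := abs_sum_mul_shift_le_five (g := fun r => detYTwoDot (stripYT 2) r)
    (e := fun m => hatC2D (stripYT 2) (m + 1) a b - (cDetTwo ^ 2 * limTwo a b * (m : ℝ) ^ 2 + linQTwoDet (limTwo a b) m₀ * (m : ℝ) + m₂))
    hR0.le hR1.le hK₁ hb₂ n
  have h1 := abs_sum_mul_shift_le_five (g := fun r => detYTwoDot (stripYT 2) r)
    (e := fun m => hatCD (stripYT 2) (m + 1) a b - (cDetTwo * limTwo a b * (m : ℝ) + m₀)) hR0.le hR1.le hK₁ hb₁ n
  have h0 := abs_sum_mul_shift_le_five (g := fun r => detYTwoDot (stripYT 2) r) (e := fun m => hatD 2 (stripYT 2) (m + 1) a b - limTwo a b)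
    hR0.le hR1.le hK₀' (hK₀ a b) n
  rw [← hS₂] at h2
  rw [← hS₁] at h1
  rw [← hS₀] at h0
  have hn1 : (1 : ℝ) ≤ (n : ℝ) + 1 := by linarith [(Nat.cast_nonneg n : (0 : ℝ) ≤ n)]
  have hp1 : ((n : ℝ) + 1) ^ 3 * rTwoDet ^ n ≤ ((n : ℝ) + 1) ^ 6 * rTwoDet ^ n :=
    mul_le_mul_of_nonneg_right (pow_le_pow_right₀ hn1 (by norm_num)) (by positivity)
  have hp0 : ((n : ℝ) + 1) ^ 0 * rTwoDet ^ n ≤ ((n : ℝ) + 1) ^ 6 * rTwoDet ^ n :=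
    mul_le_mul_of_nonneg_right (pow_le_pow_right₀ hn1 (by norm_num)) (by positivity)
  have h1' := h1.trans (mul_le_mul_of_nonneg_left hp1 hS₁0)
  have h0' := h0.trans (mul_le_mul_of_nonneg_left hp0 hS₀0)
  set X₂ := ∑ r ∈ range 5, detYTwoDot (stripYT 2) r * (hatC2D (stripYT 2) (n + r + 1) a b
      - (cDetTwo ^ 2 * limTwo a b * ((n + r : ℕ) : ℝ) ^ 2 + linQTwoDet (limTwo a b) m₀ * ((n + r : ℕ) : ℝ) + m₂)) with hX₂
  set X₁ := ∑ r ∈ range 5, detYTwoDot (stripYT 2) r * (hatCD (stripYT 2) (n + r + 1) a b - (cDetTwo * limTwo a b * ((n + r : ℕ) : ℝ) + m₀)) with hX₁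
  set X₀ := ∑ r ∈ range 5, detYTwoDot (stripYT 2) r * (hatD 2 (stripYT 2) (n + r + 1) a b - limTwo a b) with hX₀
  set W := ((n : ℝ) + 1) ^ 6 * rTwoDet ^ n with hW
  calc |3 * X₂ + 3 * X₁ + X₀| ≤ |3 * X₂ + 3 * X₁| + |X₀| := abs_add_le _ _
    _ ≤ (|3 * X₂| + |3 * X₁|) + |X₀| := by gcongr; exact abs_add_le _ _
    _ = 3 * |X₂| + 3 * |X₁| + |X₀| := by rw [abs_mul, abs_mul, abs_of_pos (by norm_num : (0 : ℝ) < 3)]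
    _ ≤ 3 * (S₂ * W) + 3 * (S₁ * W) + S₀ * W := by gcongr
    _ = (3 * S₂ + 3 * S₁ + S₀) * ((n : ℝ) + 1) ^ 6 * rTwoDet ^ n := by rw [hW]; ring

/-- ★★★ **The cube-weighted contact sums of `S₂` grow cubically with forced leading coefficient `c³A`**: `∃ m₀ m₂ m₃ K` with the linear and quadratic laws and
`|Ĉ³(n+1)_{ab} − (α/3·n³ + (β−α)/2·n² + (α/6 − β/2 + γ)·n + m₃)| ≤ K(n+1)⁹Rⁿ` (`α = cubATwoDet A`, `β = cubBTwoDet A m₀`, `γ = cubCTwoDet A m₀ m₂`).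
[cite: Feller1968, XIII.6; Stanley2012EC1, §4.1 Theorem 4.1.1 (iii); lane «pcv-sawmu» a-p2 g29 — own result, not in print] -/
theorem exists_hatC3D_two_cubic (a b : Fin (2 * 2)) :
    ∃ m₀ m₂ m₃ K : ℝ,
      (∀ n : ℕ, |hatCD (stripYT 2) (n + 1) a b - (cDetTwo * limTwo a b * (n : ℝ) + m₀)| ≤ K * ((n : ℝ) + 1) ^ 3 * rTwoDet ^ n) ∧
      (∀ n : ℕ, |hatC2D (stripYT 2) (n + 1) a b - (cDetTwo ^ 2 * limTwo a b * (n : ℝ) ^ 2 + linQTwoDet (limTwo a b) m₀ * (n : ℝ) + m₂)|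
        ≤ K * ((n : ℝ) + 1) ^ 6 * rTwoDet ^ n) ∧
      ∀ n : ℕ, |hatC3DTwo (stripYT 2) (n + 1) a b - (cubATwoDet (limTwo a b) / 3 * (n : ℝ) ^ 3
          + (cubBTwoDet (limTwo a b) m₀ - cubATwoDet (limTwo a b)) / 2 * (n : ℝ) ^ 2
          + (cubATwoDet (limTwo a b) / 6 - cubBTwoDet (limTwo a b) m₀ / 2 + cubCTwoDet (limTwo a b) m₀ m₂) * (n : ℝ) + m₃)|
        ≤ K * ((n : ℝ) + 1) ^ 9 * rTwoDet ^ n := by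
  obtain ⟨hQm, hdeg⟩ := qMonicTwo_monic
  obtain ⟨hR0, hR1, hR35, -⟩ := rTwoDet_facts
  have hT : tOneTwo ≠ 0 := (exists_hatCD_two_linear_det a b).1
  obtain ⟨m₀, m₂, K₁, hK₁, hb₁, hb₂⟩ := exists_hatC2D_two_quadratic_det a b
  obtain ⟨K₂, hK₂, hw⟩ := hatC3D_two_recurrence_bound a b hK₁ hb₁ hb₂
  set A := limTwo a b with hA
  have hα : cubATwoDet A * tOneTwo = cubSrc2TwoDet A := by rw [cubATwoDet]; field_simp
  have hβ : cubBTwoDet A m₀ * tOneTwo = cubSrc1TwoDet A m₀ - 2 * cubATwoDet A * (tTwoTwo / 2) := by rw [cubBTwoDet]; field_simp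
  have hγ : cubCTwoDet A m₀ m₂ * tOneTwo = cubSrc0TwoDet A m₀ m₂ - cubATwoDet A * (tThreeTwo / 3 + tTwoTwo / 2) - cubBTwoDet A m₀ * (tTwoTwo / 2) := by
    rw [cubCTwoDet]; field_simp
  obtain ⟨m₃, K₃, hK₃, hb₃⟩ := Literature.Analysis.exists_abs_sub_cubic_le_of_linearRecurrence_one_real
    (w := fun m => hatC3DTwo (stripYT 2) (m + 1) a b) hQm hR0 hR1 (fun z hz => (qMonicTwo_root_norm_le hz).trans hR35)
    sum_coeff_qMonicTwo sum_coeff_mul_qMonicTwo sum_coeff_sq_qMonicTwo hα hβ hγ hK₂ hw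
  refine ⟨m₀, m₂, m₃, max K₁ K₃, fun n => (hb₁ n).trans ?_, fun n => (hb₂ n).trans ?_, fun n => ?_⟩
  · gcongr; exact le_max_left _ _
  · gcongr; exact le_max_left _ _
  have h := hb₃ n
  rw [hdeg] at h
  exact h.trans (by gcongr; exact le_max_right _ _)

/-! ## §2 The skewness law of `S₂` -/

/-- `L₃ := (y∂_y)³λ(y₂)` from the det scalars (third implicit derivative; `Σr(r−1)ṫ = trryTwo − tlyTwo`, `Σrẗ = T_λy`, `T_yyy = T_y`).
[cite: Feller1968, XIII.6; lane «pcv-sawmu» a-p2 g29] -/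
def cThreeDetTwo : ℝ :=
  -((tThreeTwo * cDetTwo + (trryTwo - tlyTwo)) * cDetTwo ^ 2 + 2 * tTwoTwo * cDetTwo * cTwoDetTwo
      + 2 * ((trryTwo - tlyTwo) * cDetTwo + tlyTwo) * cDetTwo + 2 * tlyTwo * cTwoDetTwo + (tTwoTwo * cDetTwo + tlyTwo) * cTwoDetTwo
      + tlyTwo * cDetTwo + tyTwo) / tOneTwo

/-- ★ `κ̂₃(T=2) := L₃ − 3L₁L₂ + 2L₁³` per hat index (`= 3459/2 − 9785√2/8`, §3). [cite: Feller1968, XIII.6; lane «pcv-sawmu» a-p2 g29] -/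
def kappaHatTwo : ℝ := cThreeDetTwo - 3 * cDetTwo * cTwoDetTwo + 2 * cDetTwo ^ 3

/-- ★ `κ₃(T=2) := κ̂₃/2` per step (`= (13836 − 9785√2)/16`, §3). [cite: Feller1968, XIII.6; lane «pcv-sawmu» a-p2 g29] -/
def kappaStepTwo : ℝ := kappaHatTwo / 2

/-- The third central moment of the number of surface contacts of a bridge `a → b` of `S₂` with hat index `k` under the critical weights.
[cite: Feller1968, XIII.6; DuminilCopinHammond2013, §2.2; lane «pcv-sawmu» a-p2 g29] -/
def thirdTopTwo (k : ℕ) (a b : Fin (2 * 2)) : ℝ :=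
  hatC3DTwo (stripYT 2) k a b / hatD 2 (stripYT 2) k a b - 3 * (hatC2D (stripYT 2) k a b / hatD 2 (stripYT 2) k a b) * meanTopTwo k a b
    + 2 * meanTopTwo k a b ^ 3

/-- The forced forms `α = 3c³A`, `ℓ = A(c₂ − c²) + 2cm₀`, `β = 3cℓ + 3cA·c₂` (plumbing). [cite: Feller1968, XIII.6; lane «pcv-sawmu» a-p2 g29] -/
theorem cubic_constants_two (hT : tOneTwo ≠ 0) (A m₀ : ℝ) :
    cubATwoDet A = 3 * cDetTwo ^ 3 * A ∧ linQTwoDet A m₀ = A * (cTwoDetTwo - cDetTwo ^ 2) + 2 * cDetTwo * m₀ ∧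
      cubBTwoDet A m₀ = 3 * cDetTwo * linQTwoDet A m₀ + 3 * cDetTwo * A * cTwoDetTwo := by
  have hty : tyTwo = -(cDetTwo * tOneTwo) := by
    have : cDetTwo * tOneTwo = -tyTwo := by rw [cDetTwo]; field_simp
    linarith
  refine ⟨?_, ?_, ?_⟩
  · rw [cubATwoDet, cubSrc2TwoDet, hty]; field_simp
  · rw [linQTwoDet, cTwoDetTwo, hty]; field_simp; ring
  · rw [cubBTwoDet, cubSrc1TwoDet, cubATwoDet, cubSrc2TwoDet, linQTwoDet, cTwoDetTwo, hty]; field_simp; ring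

/-- ★ The skewness-rate identity for `S₂` (the intercepts cancel). [cite: Feller1968, XIII.6; lane «pcv-sawmu» a-p2 g29 — own] -/
theorem skewRate_identity_two (hT : tOneTwo ≠ 0) {A : ℝ} (hA : A ≠ 0) (m₀ m₂ : ℝ) :
    ((cubATwoDet A - (cubBTwoDet A m₀ - cubATwoDet A) + (cubATwoDet A / 6 - cubBTwoDet A m₀ / 2 + cubCTwoDet A m₀ m₂)) * A ^ 2
        - 3 * ((linQTwoDet A m₀ - 2 * cDetTwo ^ 2 * A) * (m₀ - cDetTwo * A) + (m₂ - linQTwoDet A m₀ + cDetTwo ^ 2 * A) * (cDetTwo * A)) * A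
        + 6 * (cDetTwo * A) * (m₀ - cDetTwo * A) ^ 2) / A ^ 3 = kappaHatTwo := by
  have hty : tyTwo = -(cDetTwo * tOneTwo) := by
    have : cDetTwo * tOneTwo = -tyTwo := by rw [cDetTwo]; field_simp
    linarith
  obtain ⟨hα, hℓ, hβ⟩ := cubic_constants_two hT A m₀
  rw [div_eq_iff (pow_ne_zero 3 hA)]
  rw [cubCTwoDet, cubSrc0TwoDet, hβ, hα, hℓ, kappaHatTwo, cThreeDetTwo, cTwoDetTwo, hty]
  field_simp
  ring

/-- ★★★ **THE WIDTH-TWO CONTACT SKEWNESS LAW**: for every pair of levels `a, b` there is `W` with `thirdTopTwo (k+1) a b − κ̂₃·(k+1) → W` (`κ̂₃ = kappaHatTwo`).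
[cite: Feller1968, XIII.6 (moments of the number of renewals); DuminilCopinHammond2013, §2.2; lane «pcv-sawmu» a-p2 g29 — own result, not in print] -/
theorem tendsto_thirdTopTwo_sub_linear (a b : Fin (2 * 2)) :
    ∃ W : ℝ, Tendsto (fun k : ℕ => thirdTopTwo (k + 1) a b - kappaHatTwo * ((k : ℝ) + 1)) atTop (𝓝 W) := by
  obtain ⟨m₀, m₂, m₃, K, hb₁, hb₂, hb₃⟩ := exists_hatC3D_two_cubic a b
  have hT : tOneTwo ≠ 0 := (exists_hatCD_two_linear_det a b).1
  obtain ⟨K₀, hK₀', hK₀⟩ := abs_hatD_two_sub_lim_le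
  obtain ⟨hR0, hR1, -, -⟩ := rTwoDet_facts
  set A : ℝ := limTwo a b with hA
  have hApos : 0 < A := limTwo_pos a b
  have hAne : A ≠ 0 := hApos.ne'
  obtain ⟨hα, hℓ, hβ⟩ := cubic_constants_two hT A m₀
  have hD : Tendsto (fun k : ℕ => ((k : ℝ) + 1) ^ 3 * (hatD 2 (stripYT 2) (k + 1) a b - A)) atTop (𝓝 0) :=
    Literature.Analysis.tendsto_succ_pow_mul_of_abs_le (e := fun n => hatD 2 (stripYT 2) (n + 1) a b - A) hR0 hR1 (fun n => hK₀ a b n) 3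
  have hC : Tendsto (fun k : ℕ => ((k : ℝ) + 1) ^ 2 * (hatCD (stripYT 2) (k + 1) a b - (cDetTwo * A * ((k : ℝ) + 1) + (m₀ - cDetTwo * A)))) atTop (𝓝 0) := by
    have h := Literature.Analysis.tendsto_succ_pow_mul_of_abs_le (e := fun n => hatCD (stripYT 2) (n + 1) a b - (cDetTwo * A * (n : ℝ) + m₀)) hR0 hR1 hb₁ 2
    refine h.congr fun k => ?_
    ring
  have hQ : Tendsto (fun k : ℕ => ((k : ℝ) + 1) * (hatC2D (stripYT 2) (k + 1) a b
      - (cDetTwo ^ 2 * A * ((k : ℝ) + 1) ^ 2 + (linQTwoDet A m₀ - 2 * cDetTwo ^ 2 * A) * ((k : ℝ) + 1)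
        + (m₂ - linQTwoDet A m₀ + cDetTwo ^ 2 * A)))) atTop (𝓝 0) := by
    have h := Literature.Analysis.tendsto_succ_pow_mul_of_abs_le
      (e := fun n => hatC2D (stripYT 2) (n + 1) a b - (cDetTwo ^ 2 * A * (n : ℝ) ^ 2 + linQTwoDet A m₀ * (n : ℝ) + m₂)) hR0 hR1 hb₂ 1
    simp only [pow_one] at h
    refine h.congr fun k => ?_
    ring
  have hP : Tendsto (fun k : ℕ => hatC3DTwo (stripYT 2) (k + 1) a b
      - (cubATwoDet A / 3 * ((k : ℝ) + 1) ^ 3 + ((cubBTwoDet A m₀ - cubATwoDet A) / 2 - cubATwoDet A) * ((k : ℝ) + 1) ^ 2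
        + (cubATwoDet A - (cubBTwoDet A m₀ - cubATwoDet A) + (cubATwoDet A / 6 - cubBTwoDet A m₀ / 2 + cubCTwoDet A m₀ m₂)) * ((k : ℝ) + 1)
        + (m₃ - (cubATwoDet A / 6 - cubBTwoDet A m₀ / 2 + cubCTwoDet A m₀ m₂) + (cubBTwoDet A m₀ - cubATwoDet A) / 2 - cubATwoDet A / 3))) atTop (𝓝 0) := by
    have h := Literature.Analysis.tendsto_succ_pow_mul_of_abs_le
      (e := fun n => hatC3DTwo (stripYT 2) (n + 1) a b - (cubATwoDet A / 3 * (n : ℝ) ^ 3 + (cubBTwoDet A m₀ - cubATwoDet A) / 2 * (n : ℝ) ^ 2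
        + (cubATwoDet A / 6 - cubBTwoDet A m₀ / 2 + cubCTwoDet A m₀ m₂) * (n : ℝ) + m₃)) hR0 hR1 hb₃ 0
    simp only [pow_zero, one_mul] at h
    refine h.congr fun k => ?_
    ring
  have h3 : cubATwoDet A / 3 * A ^ 2 - 3 * (cDetTwo ^ 2 * A) * (cDetTwo * A) * A + 2 * (cDetTwo * A) ^ 3 = 0 := by rw [hα]; ring
  have h2 : ((cubBTwoDet A m₀ - cubATwoDet A) / 2 - cubATwoDet A) * A ^ 2
      - 3 * (cDetTwo ^ 2 * A * (m₀ - cDetTwo * A) + (linQTwoDet A m₀ - 2 * cDetTwo ^ 2 * A) * (cDetTwo * A)) * A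
      + 6 * (cDetTwo * A) ^ 2 * (m₀ - cDetTwo * A) = 0 := by
    rw [hβ, hα, hℓ]; ring
  have h := W3.tendsto_ratio_third_central_sub_linear (D := fun k => hatD 2 (stripYT 2) (k + 1) a b) (C := fun k => hatCD (stripYT 2) (k + 1) a b)
    (Q := fun k => hatC2D (stripYT 2) (k + 1) a b) (P := fun k => hatC3DTwo (stripYT 2) (k + 1) a b) hAne h3 h2 hD hC hQ hP
  rw [skewRate_identity_two hT hAne m₀ m₂] at h
  refine ⟨_, h.congr fun k => ?_⟩
  simp only [thirdTopTwo, meanTopTwo]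

/-- Corollary: `thirdTopTwo k a b / k → κ̂₃`. [cite: Feller1968, XIII.6; lane «pcv-sawmu» a-p2 g29] -/
theorem tendsto_thirdTopTwo_div (a b : Fin (2 * 2)) :
    Tendsto (fun k : ℕ => thirdTopTwo k a b / (k : ℝ)) atTop (𝓝 kappaHatTwo) := by
  obtain ⟨W, h⟩ := tendsto_thirdTopTwo_sub_linear a b
  have hinv : Tendsto (fun k : ℕ => ((k : ℝ) + 1)⁻¹) atTop (𝓝 0) := by
    have := (tendsto_one_div_add_atTop_nhds_zero_nat : Tendsto (fun n : ℕ => 1 / ((n : ℝ) + 1)) atTop (𝓝 0))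
    simpa using this
  have t := (h.mul hinv).add_const kappaHatTwo
  rw [mul_zero, zero_add] at t
  have t' : Tendsto (fun k : ℕ => thirdTopTwo (k + 1) a b / (((k + 1 : ℕ) : ℝ))) atTop (𝓝 kappaHatTwo) := by
    refine t.congr fun k => ?_
    have hk : ((k : ℝ) + 1) ≠ 0 := by positivity
    push_cast
    field_simp
    ring
  exact (tendsto_add_atTop_iff_nat 1).1 t'

/-- `k/(2k + χ_a − χ_b) → 1/2` for the width-two levels (plumbing). [cite: Feller1968, XIII.3; lane plumbing] -/
theorem tendsto_div_hatLen_two (a b : Fin (2 * 2)) :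
    Tendsto (fun k : ℕ => (k : ℝ) / ((hatLen k a b : ℤ) : ℝ)) atTop (𝓝 (1 / 2)) := by
  set c : ℝ := ((lchi a : ℤ) : ℝ) - ((lchi b : ℤ) : ℝ) with hc
  have hinv : Tendsto (fun k : ℕ => ((k : ℝ))⁻¹) atTop (𝓝 0) := tendsto_inv_atTop_zero.comp tendsto_natCast_atTop_atTop
  have t0 : Tendsto (fun k : ℕ => 2 + c * ((k : ℝ))⁻¹) atTop (𝓝 (2 + c * 0)) := (hinv.const_mul c).const_add 2
  rw [mul_zero, add_zero] at t0
  have t : Tendsto (fun k : ℕ => (2 + c * ((k : ℝ))⁻¹)⁻¹) atTop (𝓝 (2⁻¹)) := t0.inv₀ (by norm_num)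
  rw [show (1 : ℝ) / 2 = 2⁻¹ by norm_num]
  refine t.congr' ?_
  filter_upwards [eventually_gt_atTop 0] with k hk
  have hk' : (k : ℝ) ≠ 0 := by exact_mod_cast hk.ne'
  have hlen : ((hatLen k a b : ℤ) : ℝ) = 2 * (k : ℝ) + c := by rw [hc, hatLen]; push_cast; ring
  rw [hlen]
  field_simp

/-- ★★★ **PER STEP**: `thirdTopTwo k a b / (number of steps) → κ₃(T=2) = kappaStepTwo` (`= (13836 − 9785√2)/16`, §3) for every pair of end levels.
[cite: Feller1968, XIII.6; DuminilCopinHammond2013, §2.2; lane «pcv-sawmu» a-p2 g29 — own result, not in print] -/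
theorem tendsto_thirdTopTwo_div_hatLen (a b : Fin (2 * 2)) :
    Tendsto (fun k : ℕ => thirdTopTwo k a b / ((hatLen k a b : ℤ) : ℝ)) atTop (𝓝 kappaStepTwo) := by
  have h := tendsto_thirdTopTwo_div a b
  have t := h.mul (tendsto_div_hatLen_two a b)
  have hlim : kappaHatTwo * (1 / 2) = kappaStepTwo := by rw [kappaStepTwo]; ring
  rw [hlim] at t
  refine t.congr' ?_
  filter_upwards [eventually_gt_atTop 0] with k hk
  have hk' : (k : ℝ) ≠ 0 := by exact_mod_cast hk.ne'
  field_simp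

/-! ## §3 Closed forms: `c = ½ + x²`, the variance rate `(96 − 67√2)/4` again, and `κ₃(T=2) = (13836 − 9785√2)/16` -/

/-- ★★ `c = ½ + x_c²` (`= (3 − √2)/2 = 2θ₂`; the det route's contact growth per hat index — cf. `phiTwo_three_eq` of #1137).
[cite: Feller1968, XIII.6; lane «pcv-sawmu» a-p2 g27/g29 — own] -/
theorem cDetTwo_eq : cDetTwo = 1 / 2 + hexCriticalFugacity ^ 2 := by
  have h1 := tOneTwo_eq
  have hy := tyTwo_eq
  have hT : tOneTwo ≠ 0 := (exists_hatCD_two_linear_det 0 0).1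
  rw [cDetTwo, div_eq_iff hT, hy, h1]
  linear_combination ((3/7 : ℝ)) * xc_minpoly

/-- ★★ **The variance rate re-derived by the det route**: `c₂ − c² = (96 − 67√2)/4` — the slope of «WIDTH-TWO CONTACT VARIANCE RATE» #1137, obtained there from the
projector algebra, here from three scalars of `det(λ − G₂)`. [cite: Feller1968, XIII.6; lane «pcv-sawmu» a-p2 g27/g29 — own cross-check] -/
theorem varRateDet_two_eq : cTwoDetTwo - cDetTwo ^ 2 = (96 - 67 * Real.sqrt 2) / 4 := by
  have h1 := tOneTwo_eq
  have h2 := tTwoTwo_eq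
  have hy := tyTwo_eq
  have hly := tlyTwo_eq
  have hT : tOneTwo ≠ 0 := (exists_hatCD_two_linear_det 0 0).1
  have hc2 : cTwoDetTwo = -39 / 4 + 73 / 2 * hexCriticalFugacity ^ 2 := by
    rw [cTwoDetTwo, div_eq_iff hT, cDetTwo_eq, h1, h2, hy, hly]
    linear_combination ((27/2 : ℝ) + (1 : ℝ) * hexCriticalFugacity ^ 2) * xc_minpoly
  rw [hc2, cDetTwo_eq, sqrt_two_eq]
  linear_combination (-(1/2 : ℝ)) * xc_minpoly

/-- ★★★ **`κ₃(T = 2) = (13836 − 9785√2)/16`** — the third cumulant rate of the surface-contact count of the critical width-two strip, an exact element of `ℚ(√2)`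
(per hat index `κ̂₃ = 3459/2 − 9785√2/8`). [cite: Feller1968, XIII.6; lane «pcv-sawmu» a-p2 g29 — own result, not in print] -/
theorem kappaStepTwo_eq : kappaStepTwo = (13836 - 9785 * Real.sqrt 2) / 16 := by
  have h1 := tOneTwo_eq
  have h2 := tTwoTwo_eq
  have h3 := tThreeTwo_eq
  have hy := tyTwo_eq
  have hly := tlyTwo_eq
  have hrr := trryTwo_eq
  have hT : tOneTwo ≠ 0 := (exists_hatCD_two_linear_det 0 0).1
  have hc2 : cTwoDetTwo = -39 / 4 + 73 / 2 * hexCriticalFugacity ^ 2 := by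
    rw [cTwoDetTwo, div_eq_iff hT, cDetTwo_eq, h1, h2, hy, hly]
    linear_combination ((27/2 : ℝ) + (1 : ℝ) * hexCriticalFugacity ^ 2) * xc_minpoly
  have hL3 : cThreeDetTwo = -6263 / 8 + 10705 / 4 * hexCriticalFugacity ^ 2 := by
    rw [cThreeDetTwo, div_eq_iff hT, hc2, cDetTwo_eq, h1, h2, h3, hy, hly, hrr]
    linear_combination ((25383/28 : ℝ) + (675/7 : ℝ) * hexCriticalFugacity ^ 2 + (3/7 : ℝ) * hexCriticalFugacity ^ 4) * xc_minpoly
  rw [kappaStepTwo, kappaHatTwo, hL3, hc2, cDetTwo_eq, sqrt_two_eq]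
  linear_combination ((-205/8 : ℝ) + (1/2 : ℝ) * hexCriticalFugacity ^ 2) * xc_minpoly

/-- `−0.12998174 < κ₃(T=2) < −0.12998173` (from the 15-digit window of `√2` of «WIDTH-THREE-ENCLOSURE»). [cite: Feller1968, XIII.6; lane «pcv-sawmu» a-p2 g29] -/
theorem kappaStepTwo_window : (-0.12998174 : ℝ) < kappaStepTwo ∧ kappaStepTwo < (-0.12998173 : ℝ) := by
  obtain ⟨hr1, hr2⟩ := W3.sqrt_two_window15
  rw [kappaStepTwo_eq]
  constructor <;> linarith

end W2

end HV

end Literature.Probability.RandomPlanarGeometry.SAW
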